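import Summits.Schanuel.Schanuel.Theorems.ZilberEacGraphResidualSimpleRoots
import Summits.Schanuel.Schanuel.Theorems.ZilberEacGraphRamifiedBranch
import HarnessLib

/-!
# The equimodular class, LXVII: the residual of Mantova–Masser's question over polynomial graphs
# after gen 26 — a top-row root `θ ≠ 0` with `T₁(θ) ≠ 0` now forces ramified-and-multiple zeros/poles

HONEST FRAMING.  Cell `pub-schanuel` (Zilber's Exponential-Algebraic Closedness, case ladder;
host summit Schanuel), seat 2, gen 26.  **`mmCase_graphBase_residual_ramified`**: the residual of
file LII (gen 25) with its clause (B) sharpened by file LXIII: if `W` (Mantova–Masser's case over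
`x₁ = p(x₀)`, `deg p ≥ 2`) has exponential points NOT Zariski dense and is not a constant fibre, then,
with `T` the top row, `T₁` the NEXT row (`x₀`-degree `N₀ - 1`) and `q_j` the rows of the irreducible
fibre polynomial `P₂`: EITHER every nonzero root `θ` of `T` is a multiple root WITH `T₁(θ) = 0` (all
branches at infinity ramified with a degenerate first Newton step), OR every root of `q₀` is multiple
with `q₁ = 0` there and every root of `q_r` is multiple with `q_{r-1} = 0` there (no zero or pole
resolved by the elementary data of files XLIV/LI); and (A′) as before.  An OPEN question in general
(Mantova–Masser, PLMS 2024 §1 p. 5); EC(3,2) OPEN; NOT Schanuel's conjecture (neither used nor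
implied; EAC ⇏ SC).
-/

noncomputable section

open Filter Topology Set Complex MvPolynomial
open Literature.NumberTheory.Transcendental Literature.ModelTheory.Zilber
open Literature.ModelTheory.ExponentialFields

set_option linter.dupNamespace false

namespace Summit.Schanuel.Schanuel.Theorems

section Residual

variable (p : Polynomial ℂ)

/-- **The residual over polynomial graphs after gen 26 (file LXIII).**  See the module docstring.
[cite: MantovaMasser2023, §1 Further remarks, p. 5 (the question, open in general)] (new) -/
theorem mmCase_graphBase_residual_ramified (hd : 2 ≤ p.natDegree)
    {W : Set (Fin 2 ⊕ Fin 2 → ℂ)} (hmm : MMCaseDimPiOneFree W)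
    (hbase : zeroLocus ℂ (vanishingIdeal ℂ (projAdd '' (W ∩ torusLocus ℂ 2))) =
      {x : Fin 2 → ℂ | x 1 = p.eval (x 0)})
    (hnot : ¬ UnprojectedDense W) :
    ∃ P₂ : MvPolynomial (Fin 2) ℂ, Irreducible P₂ ∧
      (∃ v ∈ P₂.support, ∃ v' ∈ P₂.support, v 1 ≠ v' 1) ∧
      W = {w : Fin 2 ⊕ Fin 2 → ℂ | w (Sum.inl 1) = p.eval (w (Sum.inl 0)) ∧
        MvPolynomial.eval ![w (Sum.inl 0), w (Sum.inr 0)] P₂ = 0} ∧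
      (p.leadingCoeff * I ^ p.natDegree).re = 0 ∧
      (∀ v₀ ∈ P₂.support, (∀ v ∈ P₂.support, v 0 ≤ v₀ 0) →
        (∃ vR ∈ P₂.support, vR 0 = v₀ 0 ∧ ∀ u ∈ P₂.support, u 1 ≤ vR 1) ∧
        (∃ vL ∈ P₂.support, vL 0 = v₀ 0 ∧ ∀ u ∈ P₂.support, vL 1 ≤ u 1)) ∧
      (∀ N₀ : ℕ, (∀ v ∈ P₂.support, v 0 ≤ N₀) → ∀ va ∈ P₂.support, ∀ vc ∈ P₂.support,
        va 0 = N₀ → vc 0 = N₀ → va 1 ≠ vc 1 → ∀ θ : ℂ, θ ≠ 0 →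
        (∑ v ∈ P₂.support.filter (fun v : Fin 2 →₀ ℕ => v 0 = N₀),
          Polynomial.C (P₂.coeff v) * Polynomial.X ^ (v 1)).eval θ = 0 →
        (p.natDegree : ℝ) * (p.leadingCoeff * I ^ (p.natDegree - 1)).re * Real.log ‖θ‖ +
          (p.coeff (p.natDegree - 1) * I ^ (p.natDegree - 1)).re = 0) ∧
      (((∃ v ∈ P₂.support, ∃ v' ∈ P₂.support, 0 < v 1 ∧ 0 < v' 1 ∧ v 1 ≠ v' 1) ∧
        ∀ N₀ r : ℕ, (∀ v ∈ P₂.support, v 0 ≤ N₀) → (∃ v ∈ P₂.support, v 0 = N₀) →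
          (∀ v ∈ P₂.support, v 1 ≤ r) → (∃ v ∈ P₂.support, v 1 = r) →
          ((∀ θ : ℂ, θ ≠ 0 →
              (∑ v ∈ P₂.support.filter (fun v : Fin 2 →₀ ℕ => v 0 = N₀),
                Polynomial.C (P₂.coeff v) * Polynomial.X ^ (v 1)).IsRoot θ →
              (Polynomial.derivative (∑ v ∈ P₂.support.filter (fun v : Fin 2 →₀ ℕ => v 0 = N₀),
                Polynomial.C (P₂.coeff v) * Polynomial.X ^ (v 1))).IsRoot θ ∧
              (∑ v ∈ P₂.support.filter (fun v : Fin 2 →₀ ℕ => v 0 = N₀ - 1),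
                Polynomial.C (P₂.coeff v) * Polynomial.X ^ (v 1)).IsRoot θ) ∨
            ((∀ a : ℂ, (∑ v ∈ P₂.support.filter (fun v : Fin 2 →₀ ℕ => v 1 = 0),
                Polynomial.C (P₂.coeff v) * Polynomial.X ^ (v 0)).IsRoot a →
              (Polynomial.derivative (∑ v ∈ P₂.support.filter (fun v : Fin 2 →₀ ℕ => v 1 = 0),
                Polynomial.C (P₂.coeff v) * Polynomial.X ^ (v 0))).IsRoot a ∧
              (∑ v ∈ P₂.support.filter (fun v : Fin 2 →₀ ℕ => v 1 = 1),
                Polynomial.C (P₂.coeff v) * Polynomial.X ^ (v 0)).IsRoot a) ∧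
             (∀ a : ℂ, (∑ v ∈ P₂.support.filter (fun v : Fin 2 →₀ ℕ => v 1 = r),
                Polynomial.C (P₂.coeff v) * Polynomial.X ^ (v 0)).IsRoot a →
              (Polynomial.derivative (∑ v ∈ P₂.support.filter (fun v : Fin 2 →₀ ℕ => v 1 = r),
                Polynomial.C (P₂.coeff v) * Polynomial.X ^ (v 0))).IsRoot a ∧
              (∑ v ∈ P₂.support.filter (fun v : Fin 2 →₀ ℕ => v 1 = r - 1),
                Polynomial.C (P₂.coeff v) * Polynomial.X ^ (v 0)).IsRoot a))) ∧
          (¬ (∑ v ∈ P₂.support.filter (fun v : Fin 2 →₀ ℕ => v 0 = N₀),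
              Polynomial.C (P₂.coeff v) * Polynomial.X ^ (v 1)).Separable ∨
          (4 ≤ r ∧ ∃ c : ℂ,
            (∑ v ∈ P₂.support.filter (fun v : Fin 2 →₀ ℕ => v 1 = 0),
              Polynomial.C (P₂.coeff v) * Polynomial.X ^ (v 0)) =
            Polynomial.C c * ∑ v ∈ P₂.support.filter (fun v : Fin 2 →₀ ℕ => v 1 = r),
              Polynomial.C (P₂.coeff v) * Polynomial.X ^ (v 0)))) ∨
        (∀ v ∈ P₂.support, v 0 = 0)) := by
  classical
  obtain ⟨P₂, hirr₂, h1, hW₂, hre, hrow, hroot, hdisj⟩ :=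
    mmCase_graphBase_residual_simpleRoots p hd hmm hbase hnot
  refine ⟨P₂, hirr₂, h1, hW₂, hre, hrow, hroot, ?_⟩
  rcases hdisj with ⟨hpos, hold⟩ | hconst
  swap
  · exact Or.inr hconst
  by_cases hconst : ∀ v ∈ P₂.support, v 0 = 0
  · exact Or.inr hconst
  refine Or.inl ⟨hpos, fun N₀ r hN hNex hr hrex => ?_⟩
  obtain ⟨hB, hA⟩ := hold N₀ r hN hNex hr hrex
  refine ⟨?_, hA⟩
  -- the rows
  set Q : Polynomial (Polynomial ℂ) :=
    ∑ v ∈ P₂.support, Polynomial.monomial (v 1) (Polynomial.monomial (v 0) (P₂.coeff v)) with hQ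
  set T : Polynomial ℂ := ∑ v ∈ P₂.support.filter (fun v : Fin 2 →₀ ℕ => v 0 = N₀),
    Polynomial.C (P₂.coeff v) * Polynomial.X ^ (v 1) with hTdef
  set T₁ : Polynomial ℂ := ∑ v ∈ P₂.support.filter (fun v : Fin 2 →₀ ℕ => v 0 = N₀ - 1),
    Polynomial.C (P₂.coeff v) * Polynomial.X ^ (v 1) with hT₁def
  have hPQ : ∀ x y : ℂ, MvPolynomial.eval ![x, y] P₂ = (Q.map (Polynomial.evalRingHom x)).eval y :=
    fun x y => eval_eq_rowsPP P₂ x y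
  have hNQ : ∀ j, (Q.coeff j).natDegree ≤ N₀ := fun j => natDegree_coeff_rowsPP_le P₂ hN j
  have hQdeg : Q.natDegree = r := natDegree_rowsPP_eq P₂ hr hrex
  have hT : ∀ j, T.coeff j = (Q.coeff j).coeff N₀ := fun j => coeff_topRowSum_eq_coeff_coeff_rowsPP P₂ N₀ j
  have hT₁ : ∀ j, T₁.coeff j = (Q.coeff j).coeff (N₀ - 1) := fun j =>
    coeff_topRowSum_eq_coeff_coeff_rowsPP P₂ (N₀ - 1) j
  have hTcoeff : ∀ j, T.coeff j = P₂.coeff (Finsupp.single 0 N₀ + Finsupp.single 1 j) :=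
    fun j => coeff_topRowSum P₂ N₀ j
  have hrowQ : ∀ j, (∑ v ∈ P₂.support.filter (fun v : Fin 2 →₀ ℕ => v 1 = j),
      Polynomial.C (P₂.coeff v) * Polynomial.X ^ (v 0)) = Q.coeff j := fun j => rowSum_eq_coeff_rowsPP P₂ j
  -- the extreme monomials of the top row
  obtain ⟨v₀, hv₀, hv₀N⟩ := hNex
  obtain ⟨⟨vR, hvR, hvR0, hvRmax⟩, ⟨vL, hvL, hvL0, hvLmin⟩⟩ := hrow v₀ hv₀ (by rw [hv₀N]; exact hN)
  rw [hv₀N] at hvR0 hvL0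
  have hvR1 : vR 1 = r := by
    obtain ⟨v, hv, hvr⟩ := hrex
    exact le_antisymm (hr vR hvR) (hvr ▸ hvRmax v hv)
  obtain ⟨u, hu, hu1⟩ := exists_support_snd_eq_zero_of_irreducible P₂ hirr₂ h1
  have hvL1 : vL 1 = 0 := Nat.le_zero.1 (hu1 ▸ hvLmin u hu)
  have hTr : T.coeff r ≠ 0 := by
    rw [hTcoeff, ← hvR0, ← hvR1, ← Literature.NumberTheory.EllipticCurves.finsupp_fin_two_eq vR]
    exact MvPolynomial.mem_support_iff.1 hvR
  have hT0c : T.coeff 0 ≠ 0 := by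
    rw [hTcoeff, ← hvL0, ← hvL1, ← Literature.NumberTheory.EllipticCurves.finsupp_fin_two_eq vL]
    exact MvPolynomial.mem_support_iff.1 hvL
  have hT0 : T ≠ 0 := fun h => hTr (by rw [h, Polynomial.coeff_zero])
  have hN1 : 1 ≤ N₀ := by
    push Not at hconst
    obtain ⟨v, hv, hv0⟩ := hconst
    have := hN v hv
    omega
  have hQ00 : Q.coeff 0 ≠ 0 := by
    intro h
    apply hT0c
    rw [hT, h, Polynomial.coeff_zero]
  have hWeq : W = {w : Fin 2 ⊕ Fin 2 → ℂ | w (Sum.inl 1) = p.eval (w (Sum.inl 0)) ∧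
      MvPolynomial.eval ![w (Sum.inl 0), w (Sum.inr 0)] P₂ = 0} := hW₂
  -- the sharpened conjunct (B)
  rcases hB with hBl | hBr
  swap
  · exact Or.inr hBr
  rw [hrowQ 0, hrowQ 1, hrowQ r, hrowQ (r - 1)]
  by_cases hpts : (∀ a : ℂ, (Q.coeff 0).IsRoot a →
      (Polynomial.derivative (Q.coeff 0)).IsRoot a ∧ (Q.coeff 1).IsRoot a) ∧
    (∀ a : ℂ, (Q.coeff r).IsRoot a →
      (Polynomial.derivative (Q.coeff r)).IsRoot a ∧ (Q.coeff (r - 1)).IsRoot a)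
  · exact Or.inr hpts
  left
  intro θ hθ0 hTθ
  refine ⟨hBl θ hθ0 hTθ, ?_⟩
  by_contra hT₁θ
  apply hnot
  rw [hWeq]
  rcases not_and_or.1 hpts with h0 | hr'
  · push Not at h0
    obtain ⟨a, ha, ha'⟩ := h0
    by_cases hder : (Polynomial.derivative (Q.coeff 0)).IsRoot a
    · exact unprojectedDense_graph_ramifiedTopRow_unramified Q hPQ hirr₂ N₀ hN1 hNQ T T₁ hT hT₁ hT0 hθ0 hTθ
        hT₁θ (Or.inl ⟨a, ha, ha' hder⟩) p hd
    · exact unprojectedDense_graph_ramifiedTopRow_simpleZero Q hPQ hirr₂ N₀ hN1 hNQ T T₁ hT hT₁ hT0 hθ0 hTθ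
        hT₁θ ha hder p hd
  · push Not at hr'
    obtain ⟨a, ha, ha'⟩ := hr'
    rw [← hQdeg] at ha ha'
    by_cases hder : (Polynomial.derivative (Q.coeff Q.natDegree)).IsRoot a
    · exact unprojectedDense_graph_ramifiedTopRow_unramified Q hPQ hirr₂ N₀ hN1 hNQ T T₁ hT hT₁ hT0 hθ0 hTθ
        hT₁θ (Or.inr ⟨hQ00, a, ha, ha' hder⟩) p hd
    · exact unprojectedDense_graph_ramifiedTopRow_simplePole Q hPQ hirr₂ N₀ hN1 hNQ T T₁ hT hT₁ hT0 hθ0 hTθ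
        hT₁θ hQ00 ha hder p hd

end Residual

end Summit.Schanuel.Schanuel.Theorems
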